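import Mathlib.Analysis.Normed.Module.FiniteDimension
import HarnessLib
import Literature.Geometry.DiscreteGeometry.KissingPatterns
import Summits.AtomisticToContinuum.Crystallization.Theorems.PalmUnimodularRigidityShellsToBarlowChartCubicGrowthAngle

/-!
# Line `birth` of crux `FreeSplittingCertificates.ShellRigidityHcp` (stmt-AtomisticToContinuum-12561): stub `stub_covering`

The `45°` covering angle of a rotated anticuboctahedron: for every linear isometry `A` of `ℝ³`
and every `x` there is `u ∈ hcpKissingPattern` with `‖x‖ ≤ √2 · ⟪x, A u⟫`, i.e. `x` is within
`45°` of one of the twelve directions `A u` (used by `stub_emptyZone`: a far site always sees a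
shell point at angle `≤ 45°`).

Proof: the case `A = id` is the tree theorem
`PalmUnimodularRigidityShellsToBarlowChart.hcp_coveringAngle`.  A linear isometry of the
finite-dimensional space `ℝ³` into itself is a linear isometric equivalence `E`
(`LinearIsometry.toLinearIsometryEquiv`); apply the `A = id` case to `E⁻¹ x` and transport the
inequality with `‖E⁻¹ x‖ = ‖x‖` and `⟪E⁻¹ x, u⟫ = ⟪E (E⁻¹ x), E u⟫ = ⟪x, A u⟫`.
Sources: folklore (inradius `1/√2` of the triangular orthobicupola with unit circumradius).
-/

noncomputable section

namespace Summit.AtomisticToContinuum.Crystallization.Theorems.ShellRigidityHcpBirth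

open Literature.Geometry.DiscreteGeometry Literature.MathematicalPhysics.StatisticalMechanics

/-- **stub_covering** (45° covering radius of the anticuboctahedron): for every linear isometry
`A` of `ℝ³` and every `x`, some vertex direction `A u`, `u ∈ hcpKissingPattern`, makes an angle
`≤ 45°` with `x`: `‖x‖ ≤ √2 ⟪x, A u⟫`. [folklore] -/
theorem stub_covering :
    ∀ (A : EuclideanSpace ℝ (Fin 3) →ₗᵢ[ℝ] EuclideanSpace ℝ (Fin 3)) (x : EuclideanSpace ℝ (Fin 3)),
      ∃ u ∈ hcpKissingPattern, ‖x‖ ≤ Real.sqrt 2 * inner ℝ x (A u) := by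
  intro A x
  set E : EuclideanSpace ℝ (Fin 3) ≃ₗᵢ[ℝ] EuclideanSpace ℝ (Fin 3) :=
    A.toLinearIsometryEquiv rfl with hE
  obtain ⟨u, hu, h⟩ :=
    PalmUnimodularRigidityShellsToBarlowChart.hcp_coveringAngle (E.symm x)
  refine ⟨u, hu, ?_⟩
  have h1 : ‖E.symm x‖ = ‖x‖ := E.symm.norm_map x
  have h2 : inner ℝ (E.symm x) u = inner ℝ x (A u) := by
    rw [← E.inner_map_map (E.symm x) u, E.apply_symm_apply, hE,
      LinearIsometry.toLinearIsometryEquiv_apply]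
  rw [h1, h2] at h
  exact h

end Summit.AtomisticToContinuum.Crystallization.Theorems.ShellRigidityHcpBirth

end
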